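import Literature.NumberTheory.BeurlingPrimes.BDTowerMellin
import Literature.NumberTheory.BeurlingPrimes.BDTowerGrowth
import Literature.NumberTheory.BeurlingPrimes.WellBehavedSystemsSec4Proofs
import HarnessLib

/-!
# The integers of the Broucke–Debruyne tower system: `N_P(x) = ax + O(x^θ)` for every `θ > 1/2`

Topic `Literature/NumberTheory/BeurlingPrimes`, grouping namespace `BDTower`. Everything in this file is PROVED.

Broucke–Debruyne 2023 §6 (arXiv:2211.08716 p. 16): "Therefore we are justified to switch the contour in (Perron) to the
line `Re s = θ`, picking up the residue `Ax + O(1)` at the point `s = 1` in the process … In conclusion we obtain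
`N(x) ≤ Ax + O(x^θ log x)`. The analysis of the lower bound for `N(x)` is similar … the discrete system inherits all the
properties analyzed above from the continuous system". For the sparse-height member the Perron step is the tree's
fixed-line inversion `wCount_asymptotic` (WeightedPerron.lean), applied verbatim as in the tree's treatment of BDR §4
(`WellBehavedSystemsSec4Proofs`, Part C): with the BV primes `P` of `BDTower.exists_approx`,
`ζ_P(s) = s/(s−1) · E(s)`, `E = towerProd · e^{Z}` (`BDTowerMellin`, `BV.zeta_eq_exp_mul_exp_Z`), `E` holomorphic on
`Re s > 1/2`, `‖E(u+it)‖ ≤ M_η (1+|t|)^η` on `σ₁ ≤ u ≤ 2` (`BDTower.norm_towerProd_le` + BV (3.2) + AM–GM), the regular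
part `H = E + dslope E 1` (`ζ_P = a/(s−1) + H`, `a = E(1)` a positive real), hence
`N_P(x) = ax + O(x^{σ₁+η})`; choosing `σ₁ = 1/2 + (θ−1/2)/2`, `η ≤ (θ−1/2)/2` gives `IntErrorLE a θ`.

* `TowerData Θ P A` — the hypotheses (`1/2 < Θ < 1`, `BV.Approx (densCut Θ) P A`);
* `TowerData.intErrorLE` — **`P.IntErrorLE a θ` for every `1/2 < θ`, with `a = Re E(1) > 0`**
  (discharges STUB `stub_towerPerron` of the CappedTowerAboveHalf skeleton, stmt-RiemannHypothesis-24867).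

## References
* [BrouckeDebruyne2023] F. Broucke, G. Debruyne, Acta Arith. 207 (2023), §6 (read).
* [BrouckeDebruyneRevesz2023] the model Perron step, §4 (tree `WellBehavedSystemsSec4Proofs`, Part C).
-/

noncomputable section

open Complex Filter Topology Set MeasureTheory

namespace Literature.NumberTheory.BeurlingPrimes

namespace BDTower

variable {Θ : ℝ} {P : Literature.Barriers.RiemannHypothesis.BeurlingPrimes} {A : ℝ}

/-- The data of the discrete tower system: `1/2 < Θ < 1` and BV (1.3) for the density `densCut Θ`.
[cite: BrouckeDebruyne2023, §6] -/
structure TowerData (Θ : ℝ) (P : Literature.Barriers.RiemannHypothesis.BeurlingPrimes) (A : ℝ) : Prop where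
  hΘ : 1 / 2 < Θ
  hΘ1 : Θ < 1
  approx : BV.Approx (densCut Θ) P A

/-- `|f| ≤ 2` on `(1,∞)`. [cite: BrouckeDebruyne2023, §6] -/
theorem TowerData.fb (hD : TowerData Θ P A) : ∀ v, 1 < v → |densCut Θ v| ≤ 2 := abs_densCut_le_two' hD.hΘ hD.hΘ1

/-- `0 ≤ g − f ≤ 0·u^{−1/2}` for `g = f`. [cite: BrouckeDebruyne2023, §6] -/
theorem TowerData.gf (_hD : TowerData Θ P A) :
    ∀ u : ℝ, 1 < u → 0 ≤ densCut Θ u - densCut Θ u ∧ densCut Θ u - densCut Θ u ≤ 0 * u ^ (-(1 / 2 : ℝ)) :=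
  fun u _ ↦ by simp

/-- `E(s) = towerProd(s) · e^{Z(s)}`, so that `ζ_P(s) = s/(s−1) · E(s)`. [cite: BrouckeDebruyne2023, §6 ("ζ_D(s) = ζ(s) F(s)")] -/
def Efn (Θ : ℝ) (P : Literature.Barriers.RiemannHypothesis.BeurlingPrimes) (s : ℂ) : ℂ :=
  towerProd Θ s * Complex.exp (BV.Z (densCut Θ) (densCut Θ) P s)

/-- The residue `a = E(1)` of `ζ_P` at `s = 1`. [cite: BrouckeDebruyne2023, §6 ("picking up the residue Ax")] -/
def resid (Θ : ℝ) (P : Literature.Barriers.RiemannHypothesis.BeurlingPrimes) : ℂ := Efn Θ P 1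

/-- The regular part `H(s) = E(s) + (E(s) − E(1))/(s−1)` (`= ζ_P(s) − a/(s−1)` off `s = 1`). [cite: BrouckeDebruyne2023, §6] -/
def Hfn (Θ : ℝ) (P : Literature.Barriers.RiemannHypothesis.BeurlingPrimes) (s : ℂ) : ℂ :=
  Efn Θ P s + dslope (Efn Θ P) 1 s

/-- **`ζ_P(s) = s/(s−1) · E(s)`** for `σ > 1`. [cite: BrouckeDebruyne2023, §6] -/
theorem TowerData.zeta_eq (hD : TowerData Θ P A) {s : ℂ} (hs : 1 < s.re) :
    P.zeta s = s / (s - 1) * Efn Θ P s := by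
  rw [BV.zeta_eq_exp_mul_exp_Z hD.approx (measurable_densCut hD.hΘ1) hD.fb (measurable_densCut hD.hΘ1) hD.gf hs,
    exp_integral_densCut hD.hΘ hD.hΘ1 hs, Efn]
  ring

/-- The half-plane `σ > 1/2` is open. [folklore] -/
private theorem isOpen_U' : IsOpen {s : ℂ | 1 / 2 < s.re} := isOpen_lt continuous_const Complex.continuous_re

/-- `E` is holomorphic on `σ > 1/2`. [cite: BrouckeDebruyne2023, §6] -/
theorem TowerData.differentiableOn_Efn (hD : TowerData Θ P A) :
    DifferentiableOn ℂ (Efn Θ P) {s : ℂ | 1 / 2 < s.re} :=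
  (differentiable_towerProd hD.hΘ1).differentiableOn.mul
    (BV.differentiableOn_Z hD.approx (measurable_densCut hD.hΘ1) hD.fb (measurable_densCut hD.hΘ1) hD.gf).cexp

/-- `H` is holomorphic on `σ > 1/2` (removable singularity at `s = 1`). [cite: BrouckeDebruyne2023, §6] -/
theorem TowerData.differentiableOn_Hfn (hD : TowerData Θ P A) :
    DifferentiableOn ℂ (Hfn Θ P) {s : ℂ | 1 / 2 < s.re} :=
  hD.differentiableOn_Efn.add
    ((Complex.differentiableOn_dslope (isOpen_U'.mem_nhds (by norm_num : (1 : ℝ) / 2 < (1 : ℂ).re))).mpr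
      hD.differentiableOn_Efn)

/-- Off `s = 1`: `H(s) = s/(s−1) · E(s) − a/(s − 1)`. [cite: BrouckeDebruyne2023, §6] -/
theorem Hfn_eq {s : ℂ} (hs : s ≠ 1) :
    Hfn Θ P s = s / (s - 1) * Efn Θ P s - resid Θ P / (s - 1) := by
  rw [Hfn, dslope_of_ne _ hs, slope_def_field, resid]
  have h1 : s - 1 ≠ 0 := sub_ne_zero.mpr hs
  field_simp
  ring

/-! ### The residue is a positive real -/

/-- A complex limit of non-negative reals is a non-negative real. [folklore] -/
private theorem mem_of_tendsto_nonneg_real {F : ℝ → ℂ} {l : Filter ℝ} [l.NeBot] {κ : ℂ}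
    (h : Tendsto F l (𝓝 κ)) (hf : ∀ᶠ x in l, (F x).im = 0 ∧ 0 ≤ (F x).re) : κ.im = 0 ∧ 0 ≤ κ.re := by
  have hS : IsClosed {z : ℂ | z.im = 0 ∧ 0 ≤ z.re} :=
    (isClosed_eq Complex.continuous_im continuous_const).inter (isClosed_le continuous_const Complex.continuous_re)
  exact hS.mem_of_tendsto h hf

/-- `ζ_P(σ)` is a non-negative real for real `σ`. [folklore] -/
private theorem zeta_ofReal_mem (Q : Literature.Barriers.RiemannHypothesis.BeurlingPrimes) (σ : ℝ) :
    (Q.zeta σ).im = 0 ∧ 0 ≤ (Q.zeta σ).re := by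
  have h : Q.zeta σ = ((∑' k : ℕ →₀ ℕ, Q.genInt k ^ (-σ) : ℝ) : ℂ) := by
    rw [Literature.Barriers.RiemannHypothesis.BeurlingPrimes.zeta, Complex.ofReal_tsum]
    refine tsum_congr fun k ↦ ?_
    rw [Complex.ofReal_cpow (Q.one_le_genInt k |> le_trans zero_le_one)]
    push_cast
    ring_nf
  rw [h, Complex.ofReal_im, Complex.ofReal_re]
  exact ⟨rfl, tsum_nonneg fun k ↦ Real.rpow_nonneg (le_trans zero_le_one (Q.one_le_genInt k)) _⟩

/-- `(σ − 1)ζ_P(σ) → a` as `σ → 1⁺`. [cite: BrouckeDebruyne2023, §6] -/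
theorem TowerData.tendsto_sub_one_mul_zeta (hD : TowerData Θ P A) :
    Tendsto (fun σ : ℝ ↦ ((σ : ℂ) - 1) * P.zeta σ) (𝓝[>] 1) (𝓝 (resid Θ P)) := by
  set F₂ : ℂ → ℂ := fun s ↦ s * Efn Θ P s with hF₂
  have hcont : ContinuousAt F₂ 1 := by
    have hE : DifferentiableAt ℂ (Efn Θ P) 1 :=
      hD.differentiableOn_Efn.differentiableAt (isOpen_U'.mem_nhds (by norm_num : (1 : ℝ) / 2 < (1 : ℂ).re))
    exact continuousAt_id.mul hE.continuousAt
  have hof : Tendsto (fun σ : ℝ ↦ (σ : ℂ)) (𝓝[>] (1 : ℝ)) (𝓝 (1 : ℂ)) :=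
    (Complex.continuous_ofReal.tendsto' 1 1 (by simp)).mono_left nhdsWithin_le_nhds
  have hn1 : F₂ 1 = resid Θ P := by simp [hF₂, resid]
  have h1 : Tendsto (fun σ : ℝ ↦ F₂ σ) (𝓝[>] (1 : ℝ)) (𝓝 (resid Θ P)) := by
    have := hcont.tendsto.comp hof
    rw [hn1] at this
    exact this
  refine h1.congr' (eventually_nhdsWithin_of_forall fun σ hσ ↦ ?_)
  have hσ1 : (1 : ℝ) < σ := hσ
  have hne : (σ : ℂ) - 1 ≠ 0 := by
    intro h0; have := congrArg Complex.re h0; simp at this; linarith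
  show F₂ σ = ((σ : ℂ) - 1) * P.zeta σ
  rw [hD.zeta_eq (by simpa using hσ1), hF₂]
  field_simp

/-- **`a` is a positive real** (`a ≠ 0` since `towerProd(1) ≠ 0`, `1 > Θ`). [cite: BrouckeDebruyne2023, §6 ("A > 0")] -/
theorem TowerData.resid_real_pos (hD : TowerData Θ P A) : (resid Θ P).im = 0 ∧ 0 < (resid Θ P).re := by
  have hne : resid Θ P ≠ 0 := by
    have h1 : towerProd Θ 1 ≠ 0 := towerProd_ne_zero_of_lt_re hD.hΘ1 (by simp; linarith [hD.hΘ1])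
    exact mul_ne_zero h1 (Complex.exp_ne_zero _)
  have hreal : (resid Θ P).im = 0 ∧ 0 ≤ (resid Θ P).re := by
    refine mem_of_tendsto_nonneg_real hD.tendsto_sub_one_mul_zeta ?_
    refine eventually_nhdsWithin_of_forall fun σ hσ ↦ ?_
    have hσ1 : (1 : ℝ) < σ := hσ
    obtain ⟨him, hre⟩ := zeta_ofReal_mem P σ
    have hsub : ((σ : ℂ) - 1) = ((σ - 1 : ℝ) : ℂ) := by push_cast; ring
    rw [hsub, Complex.re_ofReal_mul, Complex.im_ofReal_mul, him, mul_zero]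
    exact ⟨rfl, mul_nonneg (by linarith) hre⟩
  refine ⟨hreal.1, lt_of_le_of_ne hreal.2 fun h0 ↦ hne (Complex.ext ?_ ?_)⟩
  · simp [← h0]
  · simp [hreal.1]

/-! ### The bound on `E` and on `H` in a strip `σ₁ ≤ σ ≤ 2`, `σ₁ > 1/2` -/

/-- The constant of (3.2) is non-negative. [cite: BrouckeVindas2024, proof of Theorem 3.1 (3.2)] -/
theorem TowerData.CZ_nonneg (hD : TowerData Θ P A) : 0 ≤ BV.CZ P A 0 := by
  have hA := hD.approx.nonneg
  have hK₀ := BV.E₁const_nonneg P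
  unfold BV.CZ
  positivity

/-- **`‖E(σ + it)‖ ≤ M (1 + |t|)^η`** for `σ₁ ≤ σ ≤ 2` (`σ₁ > 1/2`) and any `η > 0`: from `BDTower.norm_towerProd_le`
(exponent `η/2`) and BV (3.2) with `e^{K√log(|t|+1)} ≪_η (1+|t|)^{η/2}`. [cite: BrouckeDebruyne2023, §6] -/
theorem TowerData.exists_Efn_bound (hD : TowerData Θ P A) {σ₁ η : ℝ} (hσ₁ : 1 / 2 < σ₁) (hη : 0 < η) :
    ∃ M : ℝ, 0 ≤ M ∧ ∀ s : ℂ, σ₁ ≤ s.re → s.re ≤ 2 → ‖Efn Θ P s‖ ≤ M * (1 + |s.im|) ^ η := by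
  have hη2 : 0 < η / 2 := by linarith
  obtain ⟨B, hB0, hB⟩ := norm_towerProd_le hD.hΘ hD.hΘ1 hη2
  set K : ℝ := BV.CZ P A 0 with hK
  have hK0 : 0 ≤ K := hD.CZ_nonneg
  have hb0 : 0 < σ₁ - 1 / 2 := by linarith
  set M : ℝ := B * Real.exp (K * (1 / (σ₁ - 1 / 2)) + K ^ 2 / (4 * (η / 2) * (σ₁ - 1 / 2))) with hM
  refine ⟨M, by positivity, fun s hs hs2 ↦ ?_⟩
  have hσ : 1 / 2 < s.re := by linarith
  set L : ℝ := Real.log (|s.im| + 1) with hL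
  have hL0 : 0 ≤ L := Real.log_nonneg (by linarith [abs_nonneg s.im])
  have hZ : ‖BV.Z (densCut Θ) (densCut Θ) P s‖ ≤ K * (1 / (s.re - 1 / 2) + Real.sqrt L / Real.sqrt (s.re - 1 / 2)) :=
    BV.norm_Z_le hD.approx (measurable_densCut hD.hΘ1) hD.fb (measurable_densCut hD.hΘ1) hD.gf hσ hs2
  have h1 : 1 / (s.re - 1 / 2) ≤ 1 / (σ₁ - 1 / 2) := one_div_le_one_div_of_le hb0 (by linarith)
  have h2 : Real.sqrt L / Real.sqrt (s.re - 1 / 2) ≤ Real.sqrt L / Real.sqrt (σ₁ - 1 / 2) :=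
    div_le_div_of_nonneg_left (Real.sqrt_nonneg _) (Real.sqrt_pos.mpr hb0) (Real.sqrt_le_sqrt (by linarith))
  have h3 : K * (Real.sqrt L / Real.sqrt (σ₁ - 1 / 2)) ≤ η / 2 * L + K ^ 2 / (4 * (η / 2) * (σ₁ - 1 / 2)) := by
    have hsq : 0 < Real.sqrt (σ₁ - 1 / 2) := Real.sqrt_pos.mpr hb0
    have := BDR4.mul_sqrt_le (c := K / Real.sqrt (σ₁ - 1 / 2)) hL0 hη2
    have e1 : K * (Real.sqrt L / Real.sqrt (σ₁ - 1 / 2)) = K / Real.sqrt (σ₁ - 1 / 2) * Real.sqrt L := by ring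
    have e2 : (K / Real.sqrt (σ₁ - 1 / 2)) ^ 2 / (4 * (η / 2)) = K ^ 2 / (4 * (η / 2) * (σ₁ - 1 / 2)) := by
      rw [div_pow, Real.sq_sqrt hb0.le]; field_simp
    rw [e1, ← e2]; exact this
  have hexpη : Real.exp (η / 2 * L) = (1 + |s.im|) ^ (η / 2) := by
    rw [hL, Real.rpow_def_of_pos (by linarith [abs_nonneg s.im]), add_comm 1 |s.im|]; ring_nf
  -- `T`-part: write `s = s.re + s.im I`
  have hT : ‖towerProd Θ s‖ ≤ B * (1 + |s.im|) ^ (η / 2) := by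
    have := hB s.re (by linarith) hs2 s.im
    rwa [show ((s.re : ℂ) + s.im * I) = s from Complex.re_add_im s] at this
  have hexpZ : ‖Complex.exp (BV.Z (densCut Θ) (densCut Θ) P s)‖ ≤
      Real.exp (K * (1 / (σ₁ - 1 / 2)) + K ^ 2 / (4 * (η / 2) * (σ₁ - 1 / 2))) * (1 + |s.im|) ^ (η / 2) := by
    calc ‖Complex.exp (BV.Z (densCut Θ) (densCut Θ) P s)‖
        ≤ Real.exp ‖BV.Z (densCut Θ) (densCut Θ) P s‖ := Complex.norm_exp_le_exp_norm _
      _ ≤ Real.exp (K * (1 / (σ₁ - 1 / 2)) + (η / 2 * L + K ^ 2 / (4 * (η / 2) * (σ₁ - 1 / 2)))) := by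
          rw [Real.exp_le_exp]
          refine hZ.trans ?_
          rw [mul_add]
          exact add_le_add (mul_le_mul_of_nonneg_left h1 hK0) ((mul_le_mul_of_nonneg_left h2 hK0).trans h3)
      _ = Real.exp (K * (1 / (σ₁ - 1 / 2)) + K ^ 2 / (4 * (η / 2) * (σ₁ - 1 / 2))) * (1 + |s.im|) ^ (η / 2) := by
          rw [← hexpη, ← Real.exp_add]; congr 1; ring
  have hpow : (1 + |s.im|) ^ (η / 2) * (1 + |s.im|) ^ (η / 2) = (1 + |s.im|) ^ η := by
    rw [← Real.rpow_add (by linarith [abs_nonneg s.im])]; ring_nf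
  rw [Efn, norm_mul]
  calc ‖towerProd Θ s‖ * ‖Complex.exp (BV.Z (densCut Θ) (densCut Θ) P s)‖
      ≤ (B * (1 + |s.im|) ^ (η / 2)) *
          (Real.exp (K * (1 / (σ₁ - 1 / 2)) + K ^ 2 / (4 * (η / 2) * (σ₁ - 1 / 2))) * (1 + |s.im|) ^ (η / 2)) :=
        mul_le_mul hT hexpZ (norm_nonneg _) (by positivity)
    _ = M * (1 + |s.im|) ^ η := by rw [hM, ← hpow]; ring

/-- **The strip bound for `H`**: for `η > 0` and `1/2 < σ₁` there is `B₀ ≥ 0` with `‖H(u+it)‖ ≤ B₀(1+|t|)^η`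
for `σ₁ ≤ u ≤ 2`, all `t`. [cite: BrouckeDebruyne2023, §6] -/
theorem TowerData.exists_strip_bound (hD : TowerData Θ P A) {σ₁ η : ℝ} (hσ₁ : 1 / 2 < σ₁) (hη : 0 < η) :
    ∃ B₀ : ℝ, 0 ≤ B₀ ∧ ∀ u : ℝ, σ₁ ≤ u → u ≤ 2 → ∀ t : ℝ, ‖Hfn Θ P ((u : ℂ) + t * I)‖ ≤ B₀ * (1 + |t|) ^ η := by
  obtain ⟨ME, hME, hE⟩ := hD.exists_Efn_bound hσ₁ hη
  -- compactness bound near `s = 1`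
  set Kc : Set ℂ := (Icc σ₁ 2) ×ℂ (Icc (-1) 1) with hKc
  have hKcpt : IsCompact Kc := isCompact_Icc.reProdIm isCompact_Icc
  have hKsub : Kc ⊆ {s : ℂ | 1 / 2 < s.re} := fun s hs ↦ by
    simp only [hKc, mem_reProdIm, mem_Icc] at hs; simp only [mem_setOf_eq]; linarith [hs.1.1]
  obtain ⟨M, hM⟩ := hKcpt.exists_bound_of_continuousOn (hD.differentiableOn_Hfn.continuousOn.mono hKsub)
  set M₁ : ℝ := 2 * ME + ‖Efn Θ P 1‖ with hM₁
  refine ⟨max M₁ (max M 0), le_max_of_le_right (le_max_right _ _), fun u hu1 hu2 t ↦ ?_⟩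
  have hone : 1 ≤ (1 + |t|) ^ η := Real.one_le_rpow (by linarith [abs_nonneg t]) hη.le
  by_cases ht : |t| ≤ 1
  · have hmem : (u : ℂ) + t * I ∈ Kc := by
      simp only [hKc, mem_reProdIm, mem_Icc, Complex.add_re, Complex.ofReal_re, Complex.mul_re, Complex.I_re,
        mul_zero, Complex.ofReal_im, Complex.I_im, mul_one, sub_self, add_zero, Complex.add_im, Complex.mul_im,
        zero_add]
      exact ⟨⟨hu1, hu2⟩, abs_le.mp ht⟩
    calc ‖Hfn Θ P ((u : ℂ) + t * I)‖ ≤ M := hM _ hmem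
      _ ≤ max M₁ (max M 0) * 1 := by rw [mul_one]; exact le_max_of_le_right (le_max_left _ _)
      _ ≤ max M₁ (max M 0) * (1 + |t|) ^ η :=
          mul_le_mul_of_nonneg_left hone (le_max_of_le_right (le_max_right _ _))
  · push Not at ht
    set s : ℂ := (u : ℂ) + t * I with hs
    have hsre : s.re = u := by simp [hs]
    have hsim : s.im = t := by simp [hs]
    have hs1 : s ≠ 1 := by
      intro h0; have := congrArg Complex.im h0; rw [hsim] at this; simp at this
      rw [this] at ht; simp at ht; linarith
    have hnorm1 : 1 ≤ ‖s - 1‖ := by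
      have := Complex.abs_im_le_norm (s - 1)
      simp only [Complex.sub_im, Complex.one_im, sub_zero, hsim] at this
      linarith [ht.le]
    have hEs := hE s (by rw [hsre]; exact hu1) (by rw [hsre]; exact hu2)
    rw [hsim] at hEs
    -- `H = E + (E − E(1))/(s−1)`
    have hH : Hfn Θ P s = Efn Θ P s + (Efn Θ P s - Efn Θ P 1) / (s - 1) := by
      rw [Hfn, dslope_of_ne _ hs1, slope_def_field]
    rw [hH]
    have hfrac : ‖(Efn Θ P s - Efn Θ P 1) / (s - 1)‖ ≤ ‖Efn Θ P s‖ + ‖Efn Θ P 1‖ := by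
      rw [norm_div]
      calc ‖Efn Θ P s - Efn Θ P 1‖ / ‖s - 1‖ ≤ ‖Efn Θ P s - Efn Θ P 1‖ / 1 :=
            div_le_div_of_nonneg_left (norm_nonneg _) one_pos hnorm1
        _ ≤ ‖Efn Θ P s‖ + ‖Efn Θ P 1‖ := by rw [div_one]; exact norm_sub_le _ _
    calc ‖Efn Θ P s + (Efn Θ P s - Efn Θ P 1) / (s - 1)‖
        ≤ ‖Efn Θ P s‖ + ‖(Efn Θ P s - Efn Θ P 1) / (s - 1)‖ := norm_add_le _ _
      _ ≤ ‖Efn Θ P s‖ + (‖Efn Θ P s‖ + ‖Efn Θ P 1‖) := add_le_add le_rfl hfrac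
      _ ≤ 2 * (ME * (1 + |t|) ^ η) + ‖Efn Θ P 1‖ * (1 + |t|) ^ η := by
          have := le_mul_of_one_le_right (norm_nonneg (Efn Θ P 1)) hone
          linarith
      _ = M₁ * (1 + |t|) ^ η := by rw [hM₁]; ring
      _ ≤ max M₁ (max M 0) * (1 + |t|) ^ η := mul_le_mul_of_nonneg_right (le_max_left _ _) (by positivity)

/-! ### Perron inversion: `N_P(x) = a x + O(x^{σ₁+η})` -/

/-- **`N_P(x) = a x + O(x^{σ₁+η})`** for `1/2 < σ₁ < 1`, `0 < η < 1` (tree `wCount_asymptotic` on `Re s = σ₁`).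
[cite: BrouckeDebruyne2023, §6 ("N(x) = Ax + O(x^θ …)")] -/
theorem TowerData.intCount_asymp (hD : TowerData Θ P A) {σ₁ η : ℝ} (hσ₁ : 1 / 2 < σ₁) (hσ₁1 : σ₁ < 1)
    (hη0 : 0 < η) (hη1 : η < 1) :
    ∃ C : ℝ, ∀ x : ℝ, 2 ≤ x → |(P.intCount x : ℝ) - (resid Θ P).re * x| ≤ C * x ^ (σ₁ + η) := by
  obtain ⟨B₀, hB₀, hHB⟩ := hD.exists_strip_bound hσ₁ hη0
  have hsum : Summable fun j ↦ P.prime j ^ (-(2 : ℝ)) := hD.approx.summable_prime_rpow_neg hD.fb (by norm_num)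
  have hG : ∀ t : ℝ, wSeries P (fun _ ↦ 1) (((2 : ℝ) : ℂ) + t * I) =
      polePart {1} (fun _ ↦ resid Θ P) (((2 : ℝ) : ℂ) + t * I) + Hfn Θ P (((2 : ℝ) : ℂ) + t * I) := by
    intro t
    have hne : ((2 : ℝ) : ℂ) + t * I ≠ 1 := by
      intro h0; have := congrArg Complex.re h0; simp at this
    rw [BDR4.wSeries_one', hD.zeta_eq (by simp), Hfn_eq hne, polePart, Finset.sum_singleton]
    push_cast; ring
  obtain ⟨C, hC⟩ := wCount_asymptotic (P := P) (w := fun _ ↦ 1) (W := 1) (fun _ ↦ zero_le_one)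
    (fun _ ↦ by norm_num) (κ := 2) two_pos hsum (σ₀ := 1 / 2) (σ₁ := σ₁) (by norm_num) hσ₁ (by linarith)
    {1} (fun _ ↦ resid Θ P) (fun p hp ↦ by rw [Finset.mem_singleton] at hp; rw [hp]; exact ⟨hσ₁1, by norm_num, le_rfl⟩)
    hD.differentiableOn_Hfn hG hη0 hη1 hB₀ hHB
  refine ⟨C, fun x hx ↦ ?_⟩
  have h := hC x hx
  rw [BDR4.wCount_one', Finset.sum_singleton, Real.rpow_one, div_one] at h
  exact h

/-- **The integers of the tower system are `θ`-well-behaved for every `θ > 1/2`**: `P.IntErrorLE a θ` with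
`a = Re E(1) > 0` (line `σ₁ = 1/2 + (θ−1/2)/2`, `η = min(1/2, (θ−1/2)/2)`). [cite: BrouckeDebruyne2023, §6] -/
theorem TowerData.intErrorLE (hD : TowerData Θ P A) {θ : ℝ} (hθ : 1 / 2 < θ) :
    0 < (resid Θ P).re ∧ P.IntErrorLE (resid Θ P).re θ := by
  refine ⟨hD.resid_real_pos.2, ?_⟩
  set σ₁ : ℝ := 1 / 2 + (min θ 1 - 1 / 2) / 2 with hσ₁def
  set η : ℝ := min (1 / 2) ((min θ 1 - 1 / 2) / 2) with hηdef
  have hm : 1 / 2 < min θ 1 := lt_min hθ (by norm_num)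
  have hm1 : min θ 1 ≤ 1 := min_le_right _ _
  have hσ₁ : 1 / 2 < σ₁ := by rw [hσ₁def]; linarith
  have hσ₁1 : σ₁ < 1 := by rw [hσ₁def]; linarith
  have hη0 : 0 < η := lt_min (by norm_num) (by linarith)
  have hη1 : η < 1 := lt_of_le_of_lt (min_le_left _ _) (by norm_num)
  have hle : σ₁ + η ≤ θ := by
    have h1 : η ≤ (min θ 1 - 1 / 2) / 2 := min_le_right _ _
    have h2 : min θ 1 ≤ θ := min_le_left _ _
    rw [hσ₁def]; linarith
  obtain ⟨C, hC⟩ := hD.intCount_asymp hσ₁ hσ₁1 hη0 hη1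
  have h0 : 0 ≤ σ₁ + η := by linarith
  have h1 : P.IntErrorLE (resid Θ P).re (σ₁ + η) :=
    Literature.Barriers.RiemannHypothesis.BeurlingPrimes.intErrorLE_of_forall_ge (P := P) (X := 2) (C := C) h0 hC
  exact Literature.Barriers.RiemannHypothesis.BeurlingPrimes.IntErrorLE.of_le (P := P) h1 hle

/-- **The Perron step of the CappedTowerAboveHalf skeleton**: for the BV primes of the tower template,
`∃ a > 0, P.IntErrorLE a θ` (`1/2 < θ`). [cite: BrouckeDebruyne2023, §6] -/
theorem exists_intErrorLE (hΘ : 1 / 2 < Θ) (hΘ1 : Θ < 1) (hA : BV.Approx (densCut Θ) P A) {θ : ℝ} (hθ : 1 / 2 < θ) :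
    ∃ a : ℝ, 0 < a ∧ P.IntErrorLE a θ :=
  ⟨(resid Θ P).re, (TowerData.intErrorLE ⟨hΘ, hΘ1, hA⟩ hθ).1, (TowerData.intErrorLE ⟨hΘ, hΘ1, hA⟩ hθ).2⟩

end BDTower

end Literature.NumberTheory.BeurlingPrimes

end
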